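import Literature.MathematicalPhysics.QuantumFieldTheory.Balaban1983to89.B8Prop6CubeMemberBdry4
import Literature.MathematicalPhysics.QuantumFieldTheory.Balaban1983to89.B8LeafKnitZd3CubBdry

/-!
# `Balaban1983to89.B8LeafKnitZd3CubBdry4` — [Balaban1985RegularSpaces] PROPOSITION 6 (p. 99) AT THE CUBE FAMILIES OF (1.131) FROM THE
# FIVE PER-MEMBER SOCKETS IN THE REPAIRED CURRENCY — THE PROP.-3-FRAME SOCKET WITH FOUR LINES — AND THE N05 LEAF FACE ON IT

statement-level skeleton of published theorems with citation tags; proofs where landed; nothing here is a claim about the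
Yang–Mills mass gap

PDF held: `paper:balaban1985-cmp99-regular-spaces-gauge-fixing` (journal page = PDF page + 74); pp. 79, 83, 86–88, 94, 98–101.

CITATION HEADER (lean-in-tree rule).  Cell `pub-ymgap` (YM Track A, HUMAN RULING D-0062), DAG node N05 = [B8], seat `pub-ymgap-dag-n05-e`
(R141 (C) fan-out, row s3b), generation g7 — FILE 2 of the four-line re-typing (FILE 1 = `B8Prop6CubeMemberBdry4`).  WHY: the p6 letters
of record in the repaired currency (this seat's g6 `B8Prop6CubeMemberGaugedBdry.prop6Printed_zdCub_bdry₅`, `…cubB8OfRecord_bdry₅`) and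
the N05 leaf face on them (`B8LeafKnitZd3CubBdry.b8LeafRS_zd3_map_of_printed_bdry₅`) carry the Prop.-3-frame b9 socket at every cube with
FIVE (1.59)-lines; the fifth (Hölder) line was LOCATED not suppliable uniformly in `k` at finite `Ω₀` (dag-n06-b g5, bus l.18652) and is
idle in every consumer (FILE 1's header).  THIS FILE lands the same three statements with the Hölder line REMOVED from that binder
(`…_d4`), i.e. exactly the letters the N06 junction in the repaired currency (`sh59D_cubeSubfamily_of_thm33` for the Theorem-4-frame socket
`SH59D` on the cube sub-family; the four-line `sockB9P3D` at every cube) is typed to serve.  Proofs: FILE 1's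
`prop6Printed_zdCub_of_thm4_b9D_d4` on `B8LeafModelZd3Bdry.thm4Printed_zd3_map_bdry` (the four Theorem-4-frame sockets ⇒ Theorem 4 as
printed on the cube sub-family), then the g6 compositions verbatim.  Kind «kernel-checked proof», theorems only, no `def`.

HONEST SCOPE.  (i) By-name re-compositions; all five sockets are HYPOTHESES (Prop. 5 ∃ base ∕ ∃ step ∕ uniqueness at every member of the
cube sub-family; [4] Thm 3.3 for `G(1)` in Theorem 4's frame and for `G(1)`, `H(1)` in Proposition 3's frame on the finite cube family WITH
exterior data), NOT discharged; none is certified false (the g5 certificates concern the un-repaired currency; the located fifth line is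
gone).  (ii) `B_∂ ≥ 0`, `4B_∂ ≤ (dL − 1)B₀` are the tree's («`L` large» against the junction's explicit `B_∂` — reported on the bus).
(iii) In the leaf face, Lemma 1 is n04's theorem, Theorem 2 is n05-a's map-level derivation from `H4`∕`H3`, Prop. 3 ∕ Thm 4 ∕ Prop. 5 ∕
Prop. 7 ∕ Thm 8 enter as printed sentences (hypotheses).  Count-neutral; N05 NOT discharged; one finite `𝕋⁴` programme at fixed `ε`,
Bałaban as printed; nothing continuum ∕ ℝ⁴ ∕ OS ∕ mass-gap ∕ Clay.  Unit `pub-ymgap-dag-n05-e` (g7), 2026-08-27.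
-/

noncomputable section

open NormedSpace

namespace Literature.MathematicalPhysics.QuantumFieldTheory.Balaban1983to89.B8LeafKnitZd3CubBdry4

open MatrixLog B7Prop1Explicit B7Prop2Explicit B7Prop1Local B7Eq92Concrete
open B7Prop4GeneralLevels (logCovIter linCovIter)
open B8Ineq132 (InAk covDerivFwd BondTouches)
open B8Eq119TwistedAxial (Restr129 InAx)
open B8Eq140Level (SideTouches)
open B8Eq146AExpansion (iEta plaqCovDeriv)
open B8Eq143PlaqExpansion (pdiv)
open B8Eq155JBound (Jcur wsup)
open B8ScaledSupNorm (bondNorm msup)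
open B8Eq184Proof (cfgExp)
open B8Eq138LandauZd (IsLandau138W covLap)
open B8Lemma1NonAbelian (mulCfg blockPairNA lemma1Printed_blockPairNA)
open B8LeafKnitRS (B8LeafRS)
open B8LeafModelZd (ZdIdx SockP5base SockP5 SockP5u)
open B8LeafModelZd3 (zdGF3)
open B8LeafModelZd3Map (thm2Printed_zd3_map_of_thm4)
open B8Eq131CubesAdmissible (cubeFam)
open B8CubeMemberZd (cubeLamS cubeLamB)
open B8LeafKnitZd3CubOfPrinted (prop3Printed_of_C₂_le)
open B8Prop6CubeMemberBdry4 (prop6Printed_zdCub_of_thm4_b9D_d4)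
open Node00 (CubeB8 zdCub)

-- `Site` alone could resolve to the torus sites of `Setup.lean`; re-export the `ℤ^d` sites of `B7Prop1Explicit`.
export B7Prop1Explicit (Site)

variable {d : ℕ}

variable {𝔸 : Type} [CStarAlgebra 𝔸] [Nontrivial 𝔸]
variable {I₃ : Type} {lan : I₃ → B8.LandauData}

/-! ## §1 `B8.Prop6Printed` on `zdCub` and on the member of record from the five sockets, the Prop.-3-frame socket with FOUR lines -/

/-- **`B8.Prop6Printed` ON `Node00.zdCub` FROM THE FIVE SOCKETS IN THE REPAIRED CURRENCY, THE PROP.-3-FRAME SOCKET WITH FOUR LINES** — this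
seat's g6 `B8Prop6CubeMemberGaugedBdry.prop6Printed_zdCub_bdry₅` with the Hölder line REMOVED from the per-cube b9 binder (and the now
unused Hölder parameters `β`, `len`, `B₀(β)` gone from the signature): Proposition 5 ∃ base ∕ ∃ step ∕ uniqueness and the (1.59) socket
of Theorem 4's frame WITH exterior data at every member of the cube sub-family (`B8LeafModelZd3Bdry.thm4Printed_zd3_map_bdry` serves
Theorem 4 as printed there), and the FOUR-LINE Prop.-3-frame b9 socket WITH exterior data at every cube.
[cite: Balaban1985RegularSpaces, Prop. 6 p.99, Thm 4 p.88, Prop. 3 p.87, Prop. 5 (1.107)–(1.109) p.94, (1.59) p.86] -/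
theorem prop6Printed_zdCub_bdry₅_d4 (hd2 : 2 ≤ d) {L : ℕ} (hL : 2 ≤ L) (inp : B8.B9Inputs) {C₂ cB9 cu cP Bbd : ℝ}
    (hB : 2 ≤ 5 * (d : ℝ) * L * inp.B₀) (hC₂ : 2097152 * ((d : ℝ) + 1) ^ 2 ≤ C₂) (hcB9 : 0 < cB9) (hcu : 0 < cu) (hcP : 0 < cP)
    (hBbd : 0 ≤ Bbd) (hBd : 4 * Bbd ≤ ((d : ℝ) * L - 1) * inp.B₀)
    (SP5base : ∀ i : {i : ZdIdx d L // ∃ (a : Site d) (M ρ : ℕ), L ≤ ρ ∧ ρ ≤ M ∧ 11 * d < M ∧ L ≤ d * M ∧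
        i.Ω = cubeFam false L a M ρ i.k ∧ i.Λs = cubeLamS L a M ρ i.k ∧ i.Λb = cubeLamB L a M ρ i.k}, SockP5base (𝔸 := 𝔸) L inp.B₀ inp.B₀' cP i.1.η i.1.k i.1.Ω i.1.Λs)
    (SP5 : ∀ i : {i : ZdIdx d L // ∃ (a : Site d) (M ρ : ℕ), L ≤ ρ ∧ ρ ≤ M ∧ 11 * d < M ∧ L ≤ d * M ∧
        i.Ω = cubeFam false L a M ρ i.k ∧ i.Λs = cubeLamS L a M ρ i.k ∧ i.Λb = cubeLamB L a M ρ i.k}, SockP5 (𝔸 := 𝔸) L inp.B₀ inp.B₀' cP i.1.η i.1.k i.1.Ω i.1.Λs)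
    (SH59D : ∀ i : {i : ZdIdx d L // ∃ (a : Site d) (M ρ : ℕ), L ≤ ρ ∧ ρ ≤ M ∧ 11 * d < M ∧ L ≤ d * M ∧
        i.Ω = cubeFam false L a M ρ i.k ∧ i.Λs = cubeLamS L a M ρ i.k ∧ i.Λb = cubeLamB L a M ρ i.k},
      (∀ α₀ α₁ : ℝ, 0 < α₀ → 0 < α₁ → α₀ + α₁ ≤ cP →
        ∀ U₀ U' : Site d → Fin d → 𝔸ˣ, (∀ x κ, U₀ x κ ∈ unitaryUnits 𝔸) → (∀ x κ, U' x κ ∈ unitaryUnits 𝔸) →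
        InAk L i.1.k i.1.η α₀ i.1.Ω U₀ → InAk L i.1.k i.1.η α₀ i.1.Ω (mulCfg U' U₀) → (∀ m, m ≤ i.1.k → InAx L m (i.1.Λs m) U₀ (mulCfg U' U₀)) →
        (∀ j, j ≤ i.1.k → ∀ (z : Site d) (μ : Fin d), (∀ x, InBox (loK L j z) (bondHiK L j z μ) x → x ∈ i.1.Ω j) →
          ‖(avgIter L (mulCfg U' U₀) j z μ : 𝔸) - (avgIter L U₀ j z μ : 𝔸)‖ ≤ α₁) →
        (∀ b ∈ {b : Site d × Fin d | SideTouches (i.1.Ω 0) b.1 b.2}, ‖((U' b.1 b.2 : 𝔸ˣ) : 𝔸) - 1‖ ≤ α₁) →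
        (∀ m, 1 ≤ m → m ≤ i.1.k → ∀ (u : Site d → 𝔸ˣ) (W : Site d → Fin d → 𝔸ˣ) (A' : Site d → Fin d → 𝔸),
          (∀ x, u x ∈ unitaryUnits 𝔸) → (∀ x, x ∉ i.1.Ω 0 → u x = 1) → mgauge U₀ u W = U' → Restr129 L m (i.1.Λs m) U₀ u →
          IsLandau138W L m i.1.η (i.1.Ω 0) (i.1.Λs m) U₀ W → (∀ y τ, IsSelfAdjoint (A' y τ)) →
          (∀ j, j ≤ m → ∀ y τ, SideTouches (i.1.Ω j) y τ →
          W y τ = cfgExp i.1.η A' y τ ∧ ‖A' y τ‖ ≤ (2 * (L * (5 * (d : ℝ) * L * inp.B₀ * (α₀ + α₁))) + 8 * (8 * inp.B₀' * (5 * (d : ℝ) * L * inp.B₀) * (α₀ + α₁))) * ((L : ℝ) ^ j * i.1.η)⁻¹) →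
          (∀ y τ, (∀ j, j ≤ m → ¬ SideTouches (i.1.Ω j) y τ) → A' y τ = 0) →
          msup L m i.1.η (-(1 : ℝ)) (fun j (b : Site d × Fin d) => SideTouches (i.1.Ω j) b.1 b.2) (fun b => A' b.1 b.2)
          ≤ inp.B₀ * (bondNorm L m i.1.η (-(3 : ℝ)) i.1.Ω (fun x μ => Jcur i.1.η U₀ A' μ x)
          + wsup 1 (fun p : {p : ℕ × (Site d × Fin d) // p.1 ≤ m ∧ p.2 ∈ i.1.Λb m p.1} =>
          linCovIter L U₀ (iEta i.1.η A') p.1.1 p.1.2.1 p.1.2.2))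
          + Bbd * msup L m i.1.η (-(1 : ℝ)) (fun j (b : Site d × Fin d) => j = 0 ∧ SideTouches (i.1.Ω 0) b.1 b.2 ∧ ¬ BondTouches (i.1.Ω 0) b.1 b.2)
              (fun b => A' b.1 b.2) ∧
          msup L m i.1.η (-(2 : ℝ)) (fun j (t : Fin d × Fin d × Site d) => SideTouches (i.1.Ω j) t.2.2 t.2.1)
          (fun t => covDerivFwd i.1.η U₀ t.1 (fun z => A' z t.2.1) t.2.2)
          ≤ inp.B₀ * (bondNorm L m i.1.η (-(3 : ℝ)) i.1.Ω (fun x μ => Jcur i.1.η U₀ A' μ x)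
          + wsup 1 (fun p : {p : ℕ × (Site d × Fin d) // p.1 ≤ m ∧ p.2 ∈ i.1.Λb m p.1} =>
          linCovIter L U₀ (iEta i.1.η A') p.1.1 p.1.2.1 p.1.2.2))
          + Bbd * msup L m i.1.η (-(1 : ℝ)) (fun j (b : Site d × Fin d) => j = 0 ∧ SideTouches (i.1.Ω 0) b.1 b.2 ∧ ¬ BondTouches (i.1.Ω 0) b.1 b.2)
              (fun b => A' b.1 b.2))))
    (SP5u : ∀ i : {i : ZdIdx d L // ∃ (a : Site d) (M ρ : ℕ), L ≤ ρ ∧ ρ ≤ M ∧ 11 * d < M ∧ L ≤ d * M ∧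
        i.Ω = cubeFam false L a M ρ i.k ∧ i.Λs = cubeLamS L a M ρ i.k ∧ i.Λb = cubeLamB L a M ρ i.k}, SockP5u (𝔸 := 𝔸) L cP cu i.1.η i.1.k i.1.Ω i.1.Λs) :
    ∃ c₁ : ℝ, 0 < c₁ ∧ ∀ {ι : Type} (f : ι → ZdIdx d L),
      (∀ (jf : ι) (c : CubeB8 d L (f jf).k (f jf).Ω),
      (∀ α₀ α₂ : ℝ, 0 < α₀ → α₀ ≤ cB9 → 0 < α₂ → α₂ ≤ cB9 →
      ∀ (U₀ W : Site d → Fin d → 𝔸ˣ), (∀ x κ, U₀ x κ ∈ unitaryUnits 𝔸) → (∀ x κ, W x κ ∈ unitaryUnits 𝔸) →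
      InAk L c.k (f jf).η α₀ (cubeFam false L c.a c.M c.ρ c.k) U₀ → InAk L c.k (f jf).η α₀ (cubeFam false L c.a c.M c.ρ c.k) (mulCfg W U₀) → IsLandau138W L c.k (f jf).η ((cubeFam false L c.a c.M c.ρ c.k) 0) (cubeLamS L c.a c.M c.ρ c.k c.k) U₀ W →
      ∀ A' : Site d → Fin d → 𝔸, (∀ y τ, IsSelfAdjoint (A' y τ)) →
      (∀ j, j ≤ c.k → ∀ (y : Site d) (τ : Fin d), SideTouches ((cubeFam false L c.a c.M c.ρ c.k) j) y τ →
      W y τ = cfgExp (f jf).η A' y τ ∧ ‖A' y τ‖ ≤ α₂ * ((L : ℝ) ^ j * (f jf).η)⁻¹) →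
      (∀ (y : Site d) (τ : Fin d), (∀ j, j ≤ c.k → ¬ SideTouches ((cubeFam false L c.a c.M c.ρ c.k) j) y τ) → A' y τ = 0) →
      msup L c.k (f jf).η (-(1 : ℝ)) (fun j (b : Site d × Fin d) => SideTouches ((cubeFam false L c.a c.M c.ρ c.k) j) b.1 b.2) (fun b => A' b.1 b.2)
      ≤ inp.B₀ * (bondNorm L c.k (f jf).η (-(3 : ℝ)) (cubeFam false L c.a c.M c.ρ c.k) (fun x μ => Jcur (f jf).η U₀ A' μ x)
      + wsup 1 (fun p : {p : ℕ × (Site d × Fin d) // p.1 ≤ c.k ∧ p.2 ∈ cubeLamB L c.a c.M c.ρ c.k c.k p.1} =>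
      linCovIter L U₀ (iEta (f jf).η A') p.1.1 p.1.2.1 p.1.2.2)) + Bbd * msup L c.k (f jf).η (-(1 : ℝ))
      (fun j (b : Site d × Fin d) => j = 0 ∧ SideTouches ((cubeFam false L c.a c.M c.ρ c.k) 0) b.1 b.2 ∧ ¬ BondTouches ((cubeFam false L c.a c.M c.ρ c.k) 0) b.1 b.2)
      (fun b => A' b.1 b.2) ∧
      msup L c.k (f jf).η (-(2 : ℝ)) (fun j (t : Fin d × Fin d × Site d) => SideTouches ((cubeFam false L c.a c.M c.ρ c.k) j) t.2.2 t.2.1)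
      (fun t => covDerivFwd (f jf).η U₀ t.1 (fun z => A' z t.2.1) t.2.2)
      ≤ inp.B₀ * (bondNorm L c.k (f jf).η (-(3 : ℝ)) (cubeFam false L c.a c.M c.ρ c.k) (fun x μ => Jcur (f jf).η U₀ A' μ x)
      + wsup 1 (fun p : {p : ℕ × (Site d × Fin d) // p.1 ≤ c.k ∧ p.2 ∈ cubeLamB L c.a c.M c.ρ c.k c.k p.1} =>
      linCovIter L U₀ (iEta (f jf).η A') p.1.1 p.1.2.1 p.1.2.2)) + Bbd * msup L c.k (f jf).η (-(1 : ℝ))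
      (fun j (b : Site d × Fin d) => j = 0 ∧ SideTouches ((cubeFam false L c.a c.M c.ρ c.k) 0) b.1 b.2 ∧ ¬ BondTouches ((cubeFam false L c.a c.M c.ρ c.k) 0) b.1 b.2)
      (fun b => A' b.1 b.2) ∧
      bondNorm L c.k (f jf).η (-(3 : ℝ)) (cubeFam false L c.a c.M c.ρ c.k) (fun x μ => pdiv (f jf).η U₀ (plaqCovDeriv (f jf).η U₀ A') μ x)
      ≤ inp.B₀ * (bondNorm L c.k (f jf).η (-(3 : ℝ)) (cubeFam false L c.a c.M c.ρ c.k) (fun x μ => Jcur (f jf).η U₀ A' μ x)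
      + wsup 1 (fun p : {p : ℕ × (Site d × Fin d) // p.1 ≤ c.k ∧ p.2 ∈ cubeLamB L c.a c.M c.ρ c.k c.k p.1} =>
      linCovIter L U₀ (iEta (f jf).η A') p.1.1 p.1.2.1 p.1.2.2)) + Bbd * msup L c.k (f jf).η (-(1 : ℝ))
      (fun j (b : Site d × Fin d) => j = 0 ∧ SideTouches ((cubeFam false L c.a c.M c.ρ c.k) 0) b.1 b.2 ∧ ¬ BondTouches ((cubeFam false L c.a c.M c.ρ c.k) 0) b.1 b.2)
      (fun b => A' b.1 b.2) ∧
      bondNorm L c.k (f jf).η (-(3 : ℝ)) (cubeFam false L c.a c.M c.ρ c.k) (fun x μ => covLap (f jf).η U₀ (fun z => A' z μ) x)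
      ≤ inp.B₀ * (bondNorm L c.k (f jf).η (-(3 : ℝ)) (cubeFam false L c.a c.M c.ρ c.k) (fun x μ => Jcur (f jf).η U₀ A' μ x)
      + wsup 1 (fun p : {p : ℕ × (Site d × Fin d) // p.1 ≤ c.k ∧ p.2 ∈ cubeLamB L c.a c.M c.ρ c.k c.k p.1} =>
      linCovIter L U₀ (iEta (f jf).η A') p.1.1 p.1.2.1 p.1.2.2)) + Bbd * msup L c.k (f jf).η (-(1 : ℝ))
      (fun j (b : Site d × Fin d) => j = 0 ∧ SideTouches ((cubeFam false L c.a c.M c.ρ c.k) 0) b.1 b.2 ∧ ¬ BondTouches ((cubeFam false L c.a c.M c.ρ c.k) 0) b.1 b.2)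
      (fun b => A' b.1 b.2))) →
      B8.Prop6Printed d (L : ℝ) (5 * (d : ℝ) * L * inp.B₀) c₁ (fun j => zdCub 𝔸 L (f j)) :=
  prop6Printed_zdCub_of_thm4_b9D_d4 (𝔸 := 𝔸) hd2 hL inp hC₂ hcB9 hBbd hBd 0 (fun _ => (0 : ℝ))
    (B8LeafModelZd3Bdry.thm4Printed_zd3_map_bdry (𝔸 := 𝔸) hd2 hL inp.B₀_pos inp.B₀'_pos hB hcu hcP hBbd hBd
      (Subtype.val : {i : ZdIdx d L // ∃ (a : Site d) (M ρ : ℕ), L ≤ ρ ∧ ρ ≤ M ∧ 11 * d < M ∧ L ≤ d * M ∧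
        i.Ω = cubeFam false L a M ρ i.k ∧ i.Λs = cubeLamS L a M ρ i.k ∧ i.Λb = cubeLamB L a M ρ i.k} → ZdIdx d L)
      SP5base SP5 SH59D SP5u)

#print axioms prop6Printed_zdCub_bdry₅_d4

/-- **`B8.Prop6Printed` ON NODE 00's MEMBER OF RECORD `Node00.cubB8OfRecord θ` FROM THE FIVE SOCKETS IN THE REPAIRED CURRENCY, THE
PROP.-3-FRAME SOCKET WITH FOUR LINES** — the `p6` letter for the record knits (twin of the g6 `prop6Printed_cubB8OfRecord_bdry₅`, Hölder
line removed): `prop6Printed_zdCub_bdry₅_d4` at `f := Subtype.val`.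
[cite: Balaban1985RegularSpaces, Prop. 6 p.99, Thm 4 p.88, Prop. 3 p.87, Prop. 5 p.94, (1.59) p.86] -/
theorem prop6Printed_cubB8OfRecord_bdry₅_d4 (θ : Node00.Stage3Params) (hD : 2 ≤ θ.D) (inp : B8.B9Inputs) {C₂ cB9 cu cP Bbd : ℝ}
    (hB : 2 ≤ 5 * (θ.D : ℝ) * θ.L * inp.B₀) (hC₂ : 2097152 * ((θ.D : ℝ) + 1) ^ 2 ≤ C₂) (hcB9 : 0 < cB9) (hcu : 0 < cu) (hcP : 0 < cP)
    (hBbd : 0 ≤ Bbd) (hBd : 4 * Bbd ≤ ((θ.D : ℝ) * θ.L - 1) * inp.B₀)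
    (SP5base : ∀ i : {i : ZdIdx θ.D θ.L // ∃ (a : Site θ.D) (M ρ : ℕ), θ.L ≤ ρ ∧ ρ ≤ M ∧ 11 * θ.D < M ∧ θ.L ≤ θ.D * M ∧
        i.Ω = cubeFam false θ.L a M ρ i.k ∧ i.Λs = cubeLamS θ.L a M ρ i.k ∧ i.Λb = cubeLamB θ.L a M ρ i.k}, SockP5base (𝔸 := θ.𝔸) θ.L inp.B₀ inp.B₀' cP i.1.η i.1.k i.1.Ω i.1.Λs)
    (SP5 : ∀ i : {i : ZdIdx θ.D θ.L // ∃ (a : Site θ.D) (M ρ : ℕ), θ.L ≤ ρ ∧ ρ ≤ M ∧ 11 * θ.D < M ∧ θ.L ≤ θ.D * M ∧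
        i.Ω = cubeFam false θ.L a M ρ i.k ∧ i.Λs = cubeLamS θ.L a M ρ i.k ∧ i.Λb = cubeLamB θ.L a M ρ i.k}, SockP5 (𝔸 := θ.𝔸) θ.L inp.B₀ inp.B₀' cP i.1.η i.1.k i.1.Ω i.1.Λs)
    (SH59D : ∀ i : {i : ZdIdx θ.D θ.L // ∃ (a : Site θ.D) (M ρ : ℕ), θ.L ≤ ρ ∧ ρ ≤ M ∧ 11 * θ.D < M ∧ θ.L ≤ θ.D * M ∧
        i.Ω = cubeFam false θ.L a M ρ i.k ∧ i.Λs = cubeLamS θ.L a M ρ i.k ∧ i.Λb = cubeLamB θ.L a M ρ i.k},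
      (∀ α₀ α₁ : ℝ, 0 < α₀ → 0 < α₁ → α₀ + α₁ ≤ cP →
        ∀ U₀ U' : Site θ.D → Fin θ.D → θ.𝔸ˣ, (∀ x κ, U₀ x κ ∈ unitaryUnits θ.𝔸) → (∀ x κ, U' x κ ∈ unitaryUnits θ.𝔸) →
        InAk θ.L i.1.k i.1.η α₀ i.1.Ω U₀ → InAk θ.L i.1.k i.1.η α₀ i.1.Ω (mulCfg U' U₀) → (∀ m, m ≤ i.1.k → InAx θ.L m (i.1.Λs m) U₀ (mulCfg U' U₀)) →
        (∀ j, j ≤ i.1.k → ∀ (z : Site θ.D) (μ : Fin θ.D), (∀ x, InBox (loK θ.L j z) (bondHiK θ.L j z μ) x → x ∈ i.1.Ω j) →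
          ‖(avgIter θ.L (mulCfg U' U₀) j z μ : θ.𝔸) - (avgIter θ.L U₀ j z μ : θ.𝔸)‖ ≤ α₁) →
        (∀ b ∈ {b : Site θ.D × Fin θ.D | SideTouches (i.1.Ω 0) b.1 b.2}, ‖((U' b.1 b.2 : θ.𝔸ˣ) : θ.𝔸) - 1‖ ≤ α₁) →
        (∀ m, 1 ≤ m → m ≤ i.1.k → ∀ (u : Site θ.D → θ.𝔸ˣ) (W : Site θ.D → Fin θ.D → θ.𝔸ˣ) (A' : Site θ.D → Fin θ.D → θ.𝔸),
          (∀ x, u x ∈ unitaryUnits θ.𝔸) → (∀ x, x ∉ i.1.Ω 0 → u x = 1) → mgauge U₀ u W = U' → Restr129 θ.L m (i.1.Λs m) U₀ u →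
          IsLandau138W θ.L m i.1.η (i.1.Ω 0) (i.1.Λs m) U₀ W → (∀ y τ, IsSelfAdjoint (A' y τ)) →
          (∀ j, j ≤ m → ∀ y τ, SideTouches (i.1.Ω j) y τ →
          W y τ = cfgExp i.1.η A' y τ ∧ ‖A' y τ‖ ≤ (2 * (θ.L * (5 * (θ.D : ℝ) * θ.L * inp.B₀ * (α₀ + α₁))) + 8 * (8 * inp.B₀' * (5 * (θ.D : ℝ) * θ.L * inp.B₀) * (α₀ + α₁))) * ((θ.L : ℝ) ^ j * i.1.η)⁻¹) →
          (∀ y τ, (∀ j, j ≤ m → ¬ SideTouches (i.1.Ω j) y τ) → A' y τ = 0) →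
          msup θ.L m i.1.η (-(1 : ℝ)) (fun j (b : Site θ.D × Fin θ.D) => SideTouches (i.1.Ω j) b.1 b.2) (fun b => A' b.1 b.2)
          ≤ inp.B₀ * (bondNorm θ.L m i.1.η (-(3 : ℝ)) i.1.Ω (fun x μ => Jcur i.1.η U₀ A' μ x)
          + wsup 1 (fun p : {p : ℕ × (Site θ.D × Fin θ.D) // p.1 ≤ m ∧ p.2 ∈ i.1.Λb m p.1} =>
          linCovIter θ.L U₀ (iEta i.1.η A') p.1.1 p.1.2.1 p.1.2.2))
          + Bbd * msup θ.L m i.1.η (-(1 : ℝ)) (fun j (b : Site θ.D × Fin θ.D) => j = 0 ∧ SideTouches (i.1.Ω 0) b.1 b.2 ∧ ¬ BondTouches (i.1.Ω 0) b.1 b.2)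
              (fun b => A' b.1 b.2) ∧
          msup θ.L m i.1.η (-(2 : ℝ)) (fun j (t : Fin θ.D × Fin θ.D × Site θ.D) => SideTouches (i.1.Ω j) t.2.2 t.2.1)
          (fun t => covDerivFwd i.1.η U₀ t.1 (fun z => A' z t.2.1) t.2.2)
          ≤ inp.B₀ * (bondNorm θ.L m i.1.η (-(3 : ℝ)) i.1.Ω (fun x μ => Jcur i.1.η U₀ A' μ x)
          + wsup 1 (fun p : {p : ℕ × (Site θ.D × Fin θ.D) // p.1 ≤ m ∧ p.2 ∈ i.1.Λb m p.1} =>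
          linCovIter θ.L U₀ (iEta i.1.η A') p.1.1 p.1.2.1 p.1.2.2))
          + Bbd * msup θ.L m i.1.η (-(1 : ℝ)) (fun j (b : Site θ.D × Fin θ.D) => j = 0 ∧ SideTouches (i.1.Ω 0) b.1 b.2 ∧ ¬ BondTouches (i.1.Ω 0) b.1 b.2)
              (fun b => A' b.1 b.2))))
    (SP5u : ∀ i : {i : ZdIdx θ.D θ.L // ∃ (a : Site θ.D) (M ρ : ℕ), θ.L ≤ ρ ∧ ρ ≤ M ∧ 11 * θ.D < M ∧ θ.L ≤ θ.D * M ∧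
        i.Ω = cubeFam false θ.L a M ρ i.k ∧ i.Λs = cubeLamS θ.L a M ρ i.k ∧ i.Λb = cubeLamB θ.L a M ρ i.k}, SockP5u (𝔸 := θ.𝔸) θ.L cP cu i.1.η i.1.k i.1.Ω i.1.Λs) :
    ∃ c₁ : ℝ, 0 < c₁ ∧
      ((∀ (jf : Node00.IdxB8 θ) (c : CubeB8 θ.D θ.L jf.1.k jf.1.Ω),
      (∀ α₀ α₂ : ℝ, 0 < α₀ → α₀ ≤ cB9 → 0 < α₂ → α₂ ≤ cB9 →
      ∀ (U₀ W : Site θ.D → Fin θ.D → θ.𝔸ˣ), (∀ x κ, U₀ x κ ∈ unitaryUnits θ.𝔸) → (∀ x κ, W x κ ∈ unitaryUnits θ.𝔸) →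
      InAk θ.L c.k jf.1.η α₀ (cubeFam false θ.L c.a c.M c.ρ c.k) U₀ → InAk θ.L c.k jf.1.η α₀ (cubeFam false θ.L c.a c.M c.ρ c.k) (mulCfg W U₀) → IsLandau138W θ.L c.k jf.1.η ((cubeFam false θ.L c.a c.M c.ρ c.k) 0) (cubeLamS θ.L c.a c.M c.ρ c.k c.k) U₀ W →
      ∀ A' : Site θ.D → Fin θ.D → θ.𝔸, (∀ y τ, IsSelfAdjoint (A' y τ)) →
      (∀ j, j ≤ c.k → ∀ (y : Site θ.D) (τ : Fin θ.D), SideTouches ((cubeFam false θ.L c.a c.M c.ρ c.k) j) y τ →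
      W y τ = cfgExp jf.1.η A' y τ ∧ ‖A' y τ‖ ≤ α₂ * ((θ.L : ℝ) ^ j * jf.1.η)⁻¹) →
      (∀ (y : Site θ.D) (τ : Fin θ.D), (∀ j, j ≤ c.k → ¬ SideTouches ((cubeFam false θ.L c.a c.M c.ρ c.k) j) y τ) → A' y τ = 0) →
      msup θ.L c.k jf.1.η (-(1 : ℝ)) (fun j (b : Site θ.D × Fin θ.D) => SideTouches ((cubeFam false θ.L c.a c.M c.ρ c.k) j) b.1 b.2) (fun b => A' b.1 b.2)
      ≤ inp.B₀ * (bondNorm θ.L c.k jf.1.η (-(3 : ℝ)) (cubeFam false θ.L c.a c.M c.ρ c.k) (fun x μ => Jcur jf.1.η U₀ A' μ x)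
      + wsup 1 (fun p : {p : ℕ × (Site θ.D × Fin θ.D) // p.1 ≤ c.k ∧ p.2 ∈ cubeLamB θ.L c.a c.M c.ρ c.k c.k p.1} =>
      linCovIter θ.L U₀ (iEta jf.1.η A') p.1.1 p.1.2.1 p.1.2.2)) + Bbd * msup θ.L c.k jf.1.η (-(1 : ℝ))
      (fun j (b : Site θ.D × Fin θ.D) => j = 0 ∧ SideTouches ((cubeFam false θ.L c.a c.M c.ρ c.k) 0) b.1 b.2 ∧ ¬ BondTouches ((cubeFam false θ.L c.a c.M c.ρ c.k) 0) b.1 b.2)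
      (fun b => A' b.1 b.2) ∧
      msup θ.L c.k jf.1.η (-(2 : ℝ)) (fun j (t : Fin θ.D × Fin θ.D × Site θ.D) => SideTouches ((cubeFam false θ.L c.a c.M c.ρ c.k) j) t.2.2 t.2.1)
      (fun t => covDerivFwd jf.1.η U₀ t.1 (fun z => A' z t.2.1) t.2.2)
      ≤ inp.B₀ * (bondNorm θ.L c.k jf.1.η (-(3 : ℝ)) (cubeFam false θ.L c.a c.M c.ρ c.k) (fun x μ => Jcur jf.1.η U₀ A' μ x)
      + wsup 1 (fun p : {p : ℕ × (Site θ.D × Fin θ.D) // p.1 ≤ c.k ∧ p.2 ∈ cubeLamB θ.L c.a c.M c.ρ c.k c.k p.1} =>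
      linCovIter θ.L U₀ (iEta jf.1.η A') p.1.1 p.1.2.1 p.1.2.2)) + Bbd * msup θ.L c.k jf.1.η (-(1 : ℝ))
      (fun j (b : Site θ.D × Fin θ.D) => j = 0 ∧ SideTouches ((cubeFam false θ.L c.a c.M c.ρ c.k) 0) b.1 b.2 ∧ ¬ BondTouches ((cubeFam false θ.L c.a c.M c.ρ c.k) 0) b.1 b.2)
      (fun b => A' b.1 b.2) ∧
      bondNorm θ.L c.k jf.1.η (-(3 : ℝ)) (cubeFam false θ.L c.a c.M c.ρ c.k) (fun x μ => pdiv jf.1.η U₀ (plaqCovDeriv jf.1.η U₀ A') μ x)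
      ≤ inp.B₀ * (bondNorm θ.L c.k jf.1.η (-(3 : ℝ)) (cubeFam false θ.L c.a c.M c.ρ c.k) (fun x μ => Jcur jf.1.η U₀ A' μ x)
      + wsup 1 (fun p : {p : ℕ × (Site θ.D × Fin θ.D) // p.1 ≤ c.k ∧ p.2 ∈ cubeLamB θ.L c.a c.M c.ρ c.k c.k p.1} =>
      linCovIter θ.L U₀ (iEta jf.1.η A') p.1.1 p.1.2.1 p.1.2.2)) + Bbd * msup θ.L c.k jf.1.η (-(1 : ℝ))
      (fun j (b : Site θ.D × Fin θ.D) => j = 0 ∧ SideTouches ((cubeFam false θ.L c.a c.M c.ρ c.k) 0) b.1 b.2 ∧ ¬ BondTouches ((cubeFam false θ.L c.a c.M c.ρ c.k) 0) b.1 b.2)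
      (fun b => A' b.1 b.2) ∧
      bondNorm θ.L c.k jf.1.η (-(3 : ℝ)) (cubeFam false θ.L c.a c.M c.ρ c.k) (fun x μ => covLap jf.1.η U₀ (fun z => A' z μ) x)
      ≤ inp.B₀ * (bondNorm θ.L c.k jf.1.η (-(3 : ℝ)) (cubeFam false θ.L c.a c.M c.ρ c.k) (fun x μ => Jcur jf.1.η U₀ A' μ x)
      + wsup 1 (fun p : {p : ℕ × (Site θ.D × Fin θ.D) // p.1 ≤ c.k ∧ p.2 ∈ cubeLamB θ.L c.a c.M c.ρ c.k c.k p.1} =>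
      linCovIter θ.L U₀ (iEta jf.1.η A') p.1.1 p.1.2.1 p.1.2.2)) + Bbd * msup θ.L c.k jf.1.η (-(1 : ℝ))
      (fun j (b : Site θ.D × Fin θ.D) => j = 0 ∧ SideTouches ((cubeFam false θ.L c.a c.M c.ρ c.k) 0) b.1 b.2 ∧ ¬ BondTouches ((cubeFam false θ.L c.a c.M c.ρ c.k) 0) b.1 b.2)
      (fun b => A' b.1 b.2))) →
      B8.Prop6Printed θ.D (θ.L : ℝ) (5 * (θ.D : ℝ) * θ.L * inp.B₀) c₁ (Node00.cubB8OfRecord θ))  := by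
  obtain ⟨c₁, hc₁, G⟩ := prop6Printed_zdCub_bdry₅_d4 (𝔸 := θ.𝔸) hD θ.two_le_L inp hB hC₂ hcB9 hcu hcP hBbd hBd SP5base SP5 SH59D SP5u
  exact ⟨c₁, hc₁, fun S => G (fun i : Node00.IdxB8 θ => i.1) S⟩

#print axioms prop6Printed_cubB8OfRecord_bdry₅_d4

/-! ## §2 The N05 leaf face on the index-mapped sub-family with `p6` from the five sockets, Prop.-3-frame socket with FOUR lines -/

/-- **THE RE-TYPED B8 LEAF ON AN INDEX-MAPPED SUB-FAMILY, PRINTED STATEMENTS AT THE `Ω₀ = ℤᵈ` MEMBERS + THE FIVE SOCKETS IN THE REPAIRED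
CURRENCY AT THE CUBE FAMILIES (PROP.-3-FRAME SOCKET WITH FOUR LINES), PROPOSITION 6 DERIVED** — this seat's g6
`B8LeafKnitZd3CubBdry.b8LeafRS_zd3_map_of_printed_bdry₅` with `p6 := prop6Printed_zdCub_bdry₅_d4`, i.e. the Hölder line removed from the
per-cube b9 binder; everything else (generic `ι : J → ZdIdx d L` with `(ι j).Ω 0 = univ`, cube index `f : J′ → ZdIdx d L`,
`l1 := lemma1Printed_blockPairNA`, `t2 := thm2Printed_zd3_map_of_thm4 H4 H3`, `p3 := H3` lifted to `C₂`, `t4 := H4`, `p5e p5u p7 t8` named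
hypotheses) verbatim.  The Hölder parameters `β`, `len`, `B₀(β)` stay: they are read by `H3` (Prop. 3 as printed concludes the Hölder member
of (1.36)) and by `B8LeafRS`.
[cite: Balaban1985RegularSpaces, Lemma 1 p.79, Thm 2 p.83, Prop. 3 p.87, Thm 4 p.88, Prop. 6 p.99 (derived); Prop. 5 p.94, (1.59) p.86, Prop. 7 p.100, Thm 8 p.101 (named hypotheses)] -/
theorem b8LeafRS_zd3_map_of_printed_bdry₅_d4 (hd2 : 2 ≤ d) {L : ℕ} (hL : 2 ≤ L) (Lb : ℕ) (β : ℝ) (len : Site d → ℝ) (inp : B8.B9Inputs)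
    {B₀β C₂ C₂c cB9 cu cP Bbd B₂ : ℝ} (hB : 2 ≤ 5 * (d : ℝ) * L * inp.B₀) (hB₀β : 0 < B₀β)
    (hC₂ : 2097152 * ((d : ℝ) + 1) ^ 2 ≤ C₂) (hC₂c : 2097152 * ((d : ℝ) + 1) ^ 2 ≤ C₂c) (hcB9 : 0 < cB9) (hcu : 0 < cu) (hcP : 0 < cP)
    (hBbd : 0 ≤ Bbd) (hBd : 4 * Bbd ≤ ((d : ℝ) * L - 1) * inp.B₀)
    (SP5base : ∀ i : {i : ZdIdx d L // ∃ (a : Site d) (M ρ : ℕ), L ≤ ρ ∧ ρ ≤ M ∧ 11 * d < M ∧ L ≤ d * M ∧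
        i.Ω = cubeFam false L a M ρ i.k ∧ i.Λs = cubeLamS L a M ρ i.k ∧ i.Λb = cubeLamB L a M ρ i.k}, SockP5base (𝔸 := 𝔸) L inp.B₀ inp.B₀' cP i.1.η i.1.k i.1.Ω i.1.Λs)
    (SP5 : ∀ i : {i : ZdIdx d L // ∃ (a : Site d) (M ρ : ℕ), L ≤ ρ ∧ ρ ≤ M ∧ 11 * d < M ∧ L ≤ d * M ∧
        i.Ω = cubeFam false L a M ρ i.k ∧ i.Λs = cubeLamS L a M ρ i.k ∧ i.Λb = cubeLamB L a M ρ i.k}, SockP5 (𝔸 := 𝔸) L inp.B₀ inp.B₀' cP i.1.η i.1.k i.1.Ω i.1.Λs)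
    (SH59D : ∀ i : {i : ZdIdx d L // ∃ (a : Site d) (M ρ : ℕ), L ≤ ρ ∧ ρ ≤ M ∧ 11 * d < M ∧ L ≤ d * M ∧
        i.Ω = cubeFam false L a M ρ i.k ∧ i.Λs = cubeLamS L a M ρ i.k ∧ i.Λb = cubeLamB L a M ρ i.k},
      (∀ α₀ α₁ : ℝ, 0 < α₀ → 0 < α₁ → α₀ + α₁ ≤ cP →
        ∀ U₀ U' : Site d → Fin d → 𝔸ˣ, (∀ x κ, U₀ x κ ∈ unitaryUnits 𝔸) → (∀ x κ, U' x κ ∈ unitaryUnits 𝔸) →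
        InAk L i.1.k i.1.η α₀ i.1.Ω U₀ → InAk L i.1.k i.1.η α₀ i.1.Ω (mulCfg U' U₀) → (∀ m, m ≤ i.1.k → InAx L m (i.1.Λs m) U₀ (mulCfg U' U₀)) →
        (∀ j, j ≤ i.1.k → ∀ (z : Site d) (μ : Fin d), (∀ x, InBox (loK L j z) (bondHiK L j z μ) x → x ∈ i.1.Ω j) →
          ‖(avgIter L (mulCfg U' U₀) j z μ : 𝔸) - (avgIter L U₀ j z μ : 𝔸)‖ ≤ α₁) →
        (∀ b ∈ {b : Site d × Fin d | SideTouches (i.1.Ω 0) b.1 b.2}, ‖((U' b.1 b.2 : 𝔸ˣ) : 𝔸) - 1‖ ≤ α₁) →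
        (∀ m, 1 ≤ m → m ≤ i.1.k → ∀ (u : Site d → 𝔸ˣ) (W : Site d → Fin d → 𝔸ˣ) (A' : Site d → Fin d → 𝔸),
          (∀ x, u x ∈ unitaryUnits 𝔸) → (∀ x, x ∉ i.1.Ω 0 → u x = 1) → mgauge U₀ u W = U' → Restr129 L m (i.1.Λs m) U₀ u →
          IsLandau138W L m i.1.η (i.1.Ω 0) (i.1.Λs m) U₀ W → (∀ y τ, IsSelfAdjoint (A' y τ)) →
          (∀ j, j ≤ m → ∀ y τ, SideTouches (i.1.Ω j) y τ →
          W y τ = cfgExp i.1.η A' y τ ∧ ‖A' y τ‖ ≤ (2 * (L * (5 * (d : ℝ) * L * inp.B₀ * (α₀ + α₁))) + 8 * (8 * inp.B₀' * (5 * (d : ℝ) * L * inp.B₀) * (α₀ + α₁))) * ((L : ℝ) ^ j * i.1.η)⁻¹) →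
          (∀ y τ, (∀ j, j ≤ m → ¬ SideTouches (i.1.Ω j) y τ) → A' y τ = 0) →
          msup L m i.1.η (-(1 : ℝ)) (fun j (b : Site d × Fin d) => SideTouches (i.1.Ω j) b.1 b.2) (fun b => A' b.1 b.2)
          ≤ inp.B₀ * (bondNorm L m i.1.η (-(3 : ℝ)) i.1.Ω (fun x μ => Jcur i.1.η U₀ A' μ x)
          + wsup 1 (fun p : {p : ℕ × (Site d × Fin d) // p.1 ≤ m ∧ p.2 ∈ i.1.Λb m p.1} =>
          linCovIter L U₀ (iEta i.1.η A') p.1.1 p.1.2.1 p.1.2.2))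
          + Bbd * msup L m i.1.η (-(1 : ℝ)) (fun j (b : Site d × Fin d) => j = 0 ∧ SideTouches (i.1.Ω 0) b.1 b.2 ∧ ¬ BondTouches (i.1.Ω 0) b.1 b.2)
              (fun b => A' b.1 b.2) ∧
          msup L m i.1.η (-(2 : ℝ)) (fun j (t : Fin d × Fin d × Site d) => SideTouches (i.1.Ω j) t.2.2 t.2.1)
          (fun t => covDerivFwd i.1.η U₀ t.1 (fun z => A' z t.2.1) t.2.2)
          ≤ inp.B₀ * (bondNorm L m i.1.η (-(3 : ℝ)) i.1.Ω (fun x μ => Jcur i.1.η U₀ A' μ x)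
          + wsup 1 (fun p : {p : ℕ × (Site d × Fin d) // p.1 ≤ m ∧ p.2 ∈ i.1.Λb m p.1} =>
          linCovIter L U₀ (iEta i.1.η A') p.1.1 p.1.2.1 p.1.2.2))
          + Bbd * msup L m i.1.η (-(1 : ℝ)) (fun j (b : Site d × Fin d) => j = 0 ∧ SideTouches (i.1.Ω 0) b.1 b.2 ∧ ¬ BondTouches (i.1.Ω 0) b.1 b.2)
              (fun b => A' b.1 b.2))))
    (SP5u : ∀ i : {i : ZdIdx d L // ∃ (a : Site d) (M ρ : ℕ), L ≤ ρ ∧ ρ ≤ M ∧ 11 * d < M ∧ L ≤ d * M ∧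
        i.Ω = cubeFam false L a M ρ i.k ∧ i.Λs = cubeLamS L a M ρ i.k ∧ i.Λb = cubeLamB L a M ρ i.k}, SockP5u (𝔸 := 𝔸) L cP cu i.1.η i.1.k i.1.Ω i.1.Λs) :
    ∃ c₁ : ℝ, 0 < c₁ ∧ ∀ {J : Type} (ι : J → ZdIdx d L), (∀ j, (ι j).Ω 0 = Set.univ) →
      B8.Thm4Printed (5 * (d : ℝ) * L * inp.B₀) (fun j : J => (zdGF3 𝔸 L β len (ι j)).toGFData) →
      B8.Prop3Printed d (L : ℝ) (2097152 * ((d : ℝ) + 1) ^ 2) inp B₀β (fun j : J => (zdGF3 𝔸 L β len (ι j)).toGFData2) →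
      ∀ {ι' : Type} (f : ι' → ZdIdx d L),
      (∀ (jf : ι') (c : CubeB8 d L (f jf).k (f jf).Ω),
      (∀ α₀ α₂ : ℝ, 0 < α₀ → α₀ ≤ cB9 → 0 < α₂ → α₂ ≤ cB9 →
      ∀ (U₀ W : Site d → Fin d → 𝔸ˣ), (∀ x κ, U₀ x κ ∈ unitaryUnits 𝔸) → (∀ x κ, W x κ ∈ unitaryUnits 𝔸) →
      InAk L c.k (f jf).η α₀ (cubeFam false L c.a c.M c.ρ c.k) U₀ → InAk L c.k (f jf).η α₀ (cubeFam false L c.a c.M c.ρ c.k) (mulCfg W U₀) → IsLandau138W L c.k (f jf).η ((cubeFam false L c.a c.M c.ρ c.k) 0) (cubeLamS L c.a c.M c.ρ c.k c.k) U₀ W →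
      ∀ A' : Site d → Fin d → 𝔸, (∀ y τ, IsSelfAdjoint (A' y τ)) →
      (∀ j, j ≤ c.k → ∀ (y : Site d) (τ : Fin d), SideTouches ((cubeFam false L c.a c.M c.ρ c.k) j) y τ →
      W y τ = cfgExp (f jf).η A' y τ ∧ ‖A' y τ‖ ≤ α₂ * ((L : ℝ) ^ j * (f jf).η)⁻¹) →
      (∀ (y : Site d) (τ : Fin d), (∀ j, j ≤ c.k → ¬ SideTouches ((cubeFam false L c.a c.M c.ρ c.k) j) y τ) → A' y τ = 0) →
      msup L c.k (f jf).η (-(1 : ℝ)) (fun j (b : Site d × Fin d) => SideTouches ((cubeFam false L c.a c.M c.ρ c.k) j) b.1 b.2) (fun b => A' b.1 b.2)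
      ≤ inp.B₀ * (bondNorm L c.k (f jf).η (-(3 : ℝ)) (cubeFam false L c.a c.M c.ρ c.k) (fun x μ => Jcur (f jf).η U₀ A' μ x)
      + wsup 1 (fun p : {p : ℕ × (Site d × Fin d) // p.1 ≤ c.k ∧ p.2 ∈ cubeLamB L c.a c.M c.ρ c.k c.k p.1} =>
      linCovIter L U₀ (iEta (f jf).η A') p.1.1 p.1.2.1 p.1.2.2)) + Bbd * msup L c.k (f jf).η (-(1 : ℝ))
      (fun j (b : Site d × Fin d) => j = 0 ∧ SideTouches ((cubeFam false L c.a c.M c.ρ c.k) 0) b.1 b.2 ∧ ¬ BondTouches ((cubeFam false L c.a c.M c.ρ c.k) 0) b.1 b.2)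
      (fun b => A' b.1 b.2) ∧
      msup L c.k (f jf).η (-(2 : ℝ)) (fun j (t : Fin d × Fin d × Site d) => SideTouches ((cubeFam false L c.a c.M c.ρ c.k) j) t.2.2 t.2.1)
      (fun t => covDerivFwd (f jf).η U₀ t.1 (fun z => A' z t.2.1) t.2.2)
      ≤ inp.B₀ * (bondNorm L c.k (f jf).η (-(3 : ℝ)) (cubeFam false L c.a c.M c.ρ c.k) (fun x μ => Jcur (f jf).η U₀ A' μ x)
      + wsup 1 (fun p : {p : ℕ × (Site d × Fin d) // p.1 ≤ c.k ∧ p.2 ∈ cubeLamB L c.a c.M c.ρ c.k c.k p.1} =>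
      linCovIter L U₀ (iEta (f jf).η A') p.1.1 p.1.2.1 p.1.2.2)) + Bbd * msup L c.k (f jf).η (-(1 : ℝ))
      (fun j (b : Site d × Fin d) => j = 0 ∧ SideTouches ((cubeFam false L c.a c.M c.ρ c.k) 0) b.1 b.2 ∧ ¬ BondTouches ((cubeFam false L c.a c.M c.ρ c.k) 0) b.1 b.2)
      (fun b => A' b.1 b.2) ∧
      bondNorm L c.k (f jf).η (-(3 : ℝ)) (cubeFam false L c.a c.M c.ρ c.k) (fun x μ => pdiv (f jf).η U₀ (plaqCovDeriv (f jf).η U₀ A') μ x)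
      ≤ inp.B₀ * (bondNorm L c.k (f jf).η (-(3 : ℝ)) (cubeFam false L c.a c.M c.ρ c.k) (fun x μ => Jcur (f jf).η U₀ A' μ x)
      + wsup 1 (fun p : {p : ℕ × (Site d × Fin d) // p.1 ≤ c.k ∧ p.2 ∈ cubeLamB L c.a c.M c.ρ c.k c.k p.1} =>
      linCovIter L U₀ (iEta (f jf).η A') p.1.1 p.1.2.1 p.1.2.2)) + Bbd * msup L c.k (f jf).η (-(1 : ℝ))
      (fun j (b : Site d × Fin d) => j = 0 ∧ SideTouches ((cubeFam false L c.a c.M c.ρ c.k) 0) b.1 b.2 ∧ ¬ BondTouches ((cubeFam false L c.a c.M c.ρ c.k) 0) b.1 b.2)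
      (fun b => A' b.1 b.2) ∧
      bondNorm L c.k (f jf).η (-(3 : ℝ)) (cubeFam false L c.a c.M c.ρ c.k) (fun x μ => covLap (f jf).η U₀ (fun z => A' z μ) x)
      ≤ inp.B₀ * (bondNorm L c.k (f jf).η (-(3 : ℝ)) (cubeFam false L c.a c.M c.ρ c.k) (fun x μ => Jcur (f jf).η U₀ A' μ x)
      + wsup 1 (fun p : {p : ℕ × (Site d × Fin d) // p.1 ≤ c.k ∧ p.2 ∈ cubeLamB L c.a c.M c.ρ c.k c.k p.1} =>
      linCovIter L U₀ (iEta (f jf).η A') p.1.1 p.1.2.1 p.1.2.2)) + Bbd * msup L c.k (f jf).η (-(1 : ℝ))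
      (fun j (b : Site d × Fin d) => j = 0 ∧ SideTouches ((cubeFam false L c.a c.M c.ρ c.k) 0) b.1 b.2 ∧ ¬ BondTouches ((cubeFam false L c.a c.M c.ρ c.k) 0) b.1 b.2)
      (fun b => A' b.1 b.2))) →
      ∀ {toAxial : ∀ j : J, (zdGF3 𝔸 L β len (ι j)).Cfg → (zdGF3 𝔸 L β len (ι j)).Pert → (zdGF3 𝔸 L β len (ι j)).Pert},
      B8.Prop5Exists inp.B₀' (5 * (d : ℝ) * L * inp.B₀) lan → B8.Prop5Unique lan →
      B8SectGH.Prop7PrintedR (fun j : J => zdGF3 𝔸 L β len (ι j)) toAxial →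
      B8Thm8Surviving.Thm8SurvivingAt 1 (5 * (d : ℝ) * L * inp.B₀) B₂ (fun j : J => zdGF3 𝔸 L β len (ι j)) →
      B8LeafRS d (L : ℝ) C₂ (5 * (d : ℝ) * L * inp.B₀) inp.B₀' (5 * (d : ℝ) * L * inp.B₀) B₂ c₁ inp B₀β (blockPairNA d Lb 𝔸)
        (fun j : J => zdGF3 𝔸 L β len (ι j)) lan (fun j : ι' => zdCub 𝔸 L (f j)) toAxial := by
  obtain ⟨c₁, hc₁, P6⟩ := prop6Printed_zdCub_bdry₅_d4 (𝔸 := 𝔸) hd2 hL inp hB hC₂c hcB9 hcu hcP hBbd hBd SP5base SP5 SH59D SP5u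
  refine ⟨c₁, hc₁, fun ι hΩ H4 H3 _ f S _ p5e p5u p7 t8 => ?_⟩
  exact
    { l1 := lemma1Printed_blockPairNA d Lb 𝔸
      t2 := thm2Printed_zd3_map_of_thm4 hd2 hL inp.B₀_pos inp.B₀'_pos hB₀β hB ι hΩ H4 H3
      p3 := prop3Printed_of_C₂_le hC₂ H3
      t4 := H4
      p5e := p5e
      p5u := p5u
      p6 := P6 f S
      p7 := p7
      t8 := t8 }

#print axioms b8LeafRS_zd3_map_of_printed_bdry₅_d4

end Literature.MathematicalPhysics.QuantumFieldTheory.Balaban1983to89.B8LeafKnitZd3CubBdry4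

end
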